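import Summits.AtomisticToContinuum.Crystallization.Theorems.GappedShellCensusCleanLimitsHaveWindowsInplaneGain3
import Summits.AtomisticToContinuum.Crystallization.Theorems.GappedShellCensusCleanLimitsHaveWindowsInplaneGain4
import Summits.AtomisticToContinuum.Crystallization.Theorems.GappedShellCensusCleanLimitsHaveWindowsInplaneGain8
import Summits.AtomisticToContinuum.Crystallization.Theorems.GappedShellCensusCleanLimitsHaveWindowsInplaneGain11

/-!
# `CleanLimitsHaveWindows` (stmt-AtomisticToContinuum-15932), line `Sketch`, stub `stub_inplaneGain`, helper 12:
# the layers of the contraction (upper sliver)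

Support file for the certified in-plane gain, contraction `λ = 199/200` on `a ∈ [99/100, 51/50]`: from the
hypotheses of the stub (interlayer bonds in `[9/10, 51/50]`, positive increments, bond-preserving competitor
heights) this file derives, for the layer-wise differences
`d(m') = Φ(a, z m' - z m, L m' - L m) - Φ(λa, z' m' - z' m, L m' - L m)`:

* `ig_far_geom_U`: the squared heights of a layer at distance `k ≥ 1` lie in `[k² D₁, k² D₂]` and the competitor's
  in `[H², H² + β₁ k²]` (helper 3);
* `ig_far_bound_U1`, `ig_far_bound_U2`: `d(m') ≥ -igEllU·(k)` for `2 ≤ k ≤ 7` (certificate tables) and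
  `d(m') ≥ -C/k⁴` for `k ≥ 8` (generic bound), on the two spacing windows `[99/100, 1]`, `[1, 51/50]`;
* `ig_adj_bound_U`: `d(m ± 1) ≥ igAdjSumU A₁ A₂ 4` (the two adjacent layers are offset layers);
* `ig_in_bound_U`: `Φ₀(a) - Φ₀(λa) ≥ 6 (E(A₁) - E(ΛA₁)) + igInSumU A₁ A₂ 4`;
* `ig_summable_f_U`: summability of the two layer families.
-/

noncomputable section

namespace Summit.AtomisticToContinuum.Crystallization.Theorems.CleanHull

open Summit.AtomisticToContinuum.Crystallization.Theorems.LayeredHull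
open Literature.MathematicalPhysics.StatisticalMechanics Finset

/-! ## Increments -/

/-- Increment bounds from the bond band: if `B₁ ≤ a²/3 + Δ² ≤ B₂`, `A₁ ≤ a² ≤ A₂`, `Δ > 0`, `D₁ ≤ B₁ - A₂/3`,
`B₂ - A₁/3 ≤ D₂` then `√D₁ ≤ Δ ≤ √D₂`, and `d₁ ≤ Δ ≤ d₂` for `d₁² ≤ D₁`, `D₂ ≤ d₂²`, `d₂ ≥ 0`. [folklore] -/
theorem ig_incr_bounds {a Δ A₁ A₂ D₁ D₂ d₁ d₂ : ℝ} (h1 : A₁ ≤ a ^ 2) (h2 : a ^ 2 ≤ A₂)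
    (hb : (9 / 10 : ℝ) ^ 2 ≤ a ^ 2 / 3 + Δ ^ 2 ∧ a ^ 2 / 3 + Δ ^ 2 ≤ (51 / 50 : ℝ) ^ 2) (hΔ : 0 < Δ)
    (hD₁ : D₁ ≤ 81 / 100 - A₂ / 3) (hD₂ : 2601 / 2500 - A₁ / 3 ≤ D₂) (hd₁ : d₁ ^ 2 ≤ D₁) (hd₂ : D₂ ≤ d₂ ^ 2)
    (hd₂0 : 0 ≤ d₂) :
    (Real.sqrt D₁ ≤ Δ ∧ Δ ≤ Real.sqrt D₂) ∧ (d₁ ≤ Δ ∧ Δ ≤ d₂) := by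
  obtain ⟨hb1, hb2⟩ := hb
  norm_num at hb1 hb2
  have hlo : D₁ ≤ Δ ^ 2 := by linarith
  have hhi : Δ ^ 2 ≤ D₂ := by linarith
  have hsq : Real.sqrt (Δ ^ 2) = Δ := Real.sqrt_sq hΔ.le
  refine ⟨⟨?_, ?_⟩, ?_, ?_⟩
  · rw [← hsq]; exact Real.sqrt_le_sqrt hlo
  · rw [← hsq]; exact Real.sqrt_le_sqrt hhi
  · nlinarith
  · nlinarith

/-! ## Far layers: geometry -/

/-- **Geometry of a far layer under the contraction.** For the layer `m'` at distance `k = |m' - m|` of a height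
profile in the band and its bond-preserving competitor: `k² D₁ ≤ H² ≤ k² D₂`, `H² ≤ H'² ≤ H² + β₁ k²`.
[folklore] -/
theorem ig_far_geom_U {a A₁ A₂ D₁ D₂ d₁ d₂ β₁ : ℝ} (z z' : ℤ → ℝ) (h1 : A₁ ≤ a ^ 2) (h2 : a ^ 2 ≤ A₂)
    (hD₁ : D₁ ≤ 81 / 100 - A₂ / 3) (hD₂ : 2601 / 2500 - A₁ / 3 ≤ D₂) (hD₁0 : 0 ≤ D₁) (hD₂0 : 0 ≤ D₂)
    (hd₁0 : 0 < d₁) (hd₁ : d₁ ^ 2 ≤ D₁) (hd₂ : D₂ ≤ d₂ ^ 2) (hd₂0 : 0 ≤ d₂)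
    (hβ : 399 / 40000 * A₂ / 3 * ((d₁ + d₂) ^ 2 / (4 * d₁ * d₂) + 399 / 40000 * A₂ / 3 / (4 * d₁ ^ 2)) ≤ β₁)
    (hband : ∀ m : ℤ, (9 / 10 : ℝ) ^ 2 ≤ a ^ 2 / 3 + (z (m + 1) - z m) ^ 2 ∧
      a ^ 2 / 3 + (z (m + 1) - z m) ^ 2 ≤ (51 / 50 : ℝ) ^ 2)
    (hpos : ∀ m : ℤ, 0 < z (m + 1) - z m)
    (hz' : ∀ m : ℤ, (z' (m + 1) - z' m) ^ 2 = (z (m + 1) - z m) ^ 2 + a ^ 2 * (1 - (199 / 200 : ℝ) ^ 2) / 3)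
    (hpos' : ∀ m : ℤ, 0 < z' (m + 1) - z' m) (m m' : ℤ) :
    ((m' - m).natAbs : ℝ) ^ 2 * D₁ ≤ (z m' - z m) ^ 2 ∧ (z m' - z m) ^ 2 ≤ ((m' - m).natAbs : ℝ) ^ 2 * D₂ ∧
      (z m' - z m) ^ 2 ≤ (z' m' - z' m) ^ 2 ∧
        (z' m' - z' m) ^ 2 ≤ (z m' - z m) ^ 2 + β₁ * ((m' - m).natAbs : ℝ) ^ 2 := by
  set k := (m' - m).natAbs with hk
  set n := min m m' with hn
  have hincr := fun j => ig_incr_bounds h1 h2 (hband j) (hpos j) hD₁ hD₂ hd₁ hd₂ hd₂0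
  rw [ig_sq_height_eq z m m', ig_sq_height_eq z' m m', ← hk, ← hn]
  -- heights from the exact window
  obtain ⟨hS1, hS2⟩ := ig_height_sq_bounds z (Real.sqrt_nonneg D₁) (fun j => (hincr j).1) n k
  rw [mul_pow, Real.sq_sqrt hD₁0] at hS1
  rw [mul_pow, Real.sq_sqrt hD₂0] at hS2
  -- the competitor
  set η := a ^ 2 * (1 - (199 / 200 : ℝ) ^ 2) / 3 with hη
  have hA₂ : 0 ≤ A₂ := le_trans (sq_nonneg a) h2
  have hη0 : 0 ≤ η := by rw [hη]; positivity
  have hηhi : η ≤ 399 / 40000 * A₂ / 3 := by rw [hη]; nlinarith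
  obtain ⟨hle, hsq⟩ := ig_vert_U z z' hd₁0 hη0 (fun j => (hincr j).2) hpos' hz' n k
  have hS0 : 0 ≤ z (n + k) - z n := by
    have := (ig_height_bounds z (fun j => (hincr j).2) n k).1
    have : (0 : ℝ) ≤ (k : ℝ) * d₁ := by positivity
    linarith
  have hd₂pos : 0 < d₂ := by
    have := (hincr 0).2
    have := hpos 0
    linarith
  refine ⟨by linarith, by linarith, pow_le_pow_left₀ hS0 hle 2, ?_⟩
  have hbr0 : 0 ≤ (d₁ + d₂) ^ 2 / (4 * d₁ * d₂) := by positivity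
  have hmono : η * ((d₁ + d₂) ^ 2 / (4 * d₁ * d₂) + η / (4 * d₁ ^ 2)) ≤ β₁ := by
    refine le_trans ?_ hβ
    have h3 : η / (4 * d₁ ^ 2) ≤ 399 / 40000 * A₂ / 3 / (4 * d₁ ^ 2) :=
      div_le_div_of_nonneg_right hηhi (by positivity)
    have h4 : 0 ≤ η / (4 * d₁ ^ 2) := by positivity
    calc η * ((d₁ + d₂) ^ 2 / (4 * d₁ * d₂) + η / (4 * d₁ ^ 2))
        ≤ η * ((d₁ + d₂) ^ 2 / (4 * d₁ * d₂) + 399 / 40000 * A₂ / 3 / (4 * d₁ ^ 2)) := by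
          apply mul_le_mul_of_nonneg_left _ hη0; linarith
      _ ≤ 399 / 40000 * A₂ / 3 * ((d₁ + d₂) ^ 2 / (4 * d₁ * d₂) + 399 / 40000 * A₂ / 3 / (4 * d₁ ^ 2)) := by
          apply mul_le_mul_of_nonneg_right hηhi; positivity
  have hk0 : (0 : ℝ) ≤ (k : ℝ) ^ 2 := by positivity
  calc (z' (n + k) - z' n) ^ 2 ≤ (z (n + k) - z n) ^ 2 + η * (k : ℝ) ^ 2 *
        ((d₁ + d₂) ^ 2 / (4 * d₁ * d₂) + η / (4 * d₁ ^ 2)) := by linarith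
    _ ≤ (z (n + k) - z n) ^ 2 + β₁ * (k : ℝ) ^ 2 := by
        have := mul_le_mul_of_nonneg_left hmono hk0
        nlinarith

/-- The reduced offset of a pair of layers. [folklore] -/
theorem ig_offset_reduce (δ : ℤ) : ∃ δ' : ℤ, (δ' = 0 ∨ δ' = 1) ∧ ∀ (b H : ℝ),
    layerInteraction lennardJones b H δ 1 = layerInteraction lennardJones b H δ' 1 := by
  by_cases h : δ % 3 = 0
  · exact ⟨0, Or.inl rfl, fun b H => by rw [layerInteraction_eq_ite, if_pos h]⟩
  · exact ⟨1, Or.inr rfl, fun b H => by rw [layerInteraction_eq_ite, if_neg h]⟩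

/-- **Far layers under the contraction, given the geometry**: the certified sum and the generic bound are lower
bounds of the layer difference. [folklore] -/
theorem ig_far_diff_U {a H H' A₁ A₂ D₁ D₂ β₁ : ℝ} {k : ℕ} (δ : ℤ) (hA₁ : 0 < A₁) (h1 : A₁ ≤ a ^ 2)
    (h2 : a ^ 2 ≤ A₂) (hh1 : (k : ℝ) ^ 2 * D₁ ≤ H ^ 2) (hh2 : H ^ 2 ≤ (k : ℝ) ^ 2 * D₂) (hH' : H ^ 2 ≤ H' ^ 2)
    (hH'2 : H' ^ 2 ≤ H ^ 2 + β₁ * (k : ℝ) ^ 2) (hβ : 0 ≤ β₁) (hone : 1 ≤ (k : ℝ) ^ 2 * D₁) :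
    (∃ δ' : ℤ, (δ' = 0 ∨ δ' = 1) ∧ igFarSumU A₁ A₂ D₁ D₂ β₁ 5 k δ' ≤
      layerInteraction lennardJones a H δ 1 - layerInteraction lennardJones (199 / 200 * a) H' δ 1) ∧
    -(β₁ * (k : ℝ) ^ 2 / (2 * A₁ ^ 4) * (9 * (((k : ℝ) ^ 2 * D₁ / A₁)⁻¹) ^ 4 +
        64 / 21 * ((1 / 3 + (k : ℝ) ^ 2 * D₁ / A₁)⁻¹) ^ 3)) ≤
      layerInteraction lennardJones a H δ 1 - layerInteraction lennardJones (199 / 200 * a) H' δ 1 := by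
  obtain ⟨δ', hδ', hred⟩ := ig_offset_reduce δ
  rw [hred, hred]
  have hβk : 0 ≤ β₁ * (k : ℝ) ^ 2 := by positivity
  refine ⟨⟨δ', hδ', ?_⟩, ?_⟩
  · unfold igFarSumU
    exact ig_layer_farU (N := 5) δ' hδ' hA₁ h1 h2 hh1 hh2 hH' hH'2 hβk hone (by norm_num)
  · exact ig_layer_genU δ' hδ' hA₁ h1 h2 hh1 hh2 hH' hH'2 hβk hone

/-- **Far layers of the contraction on the window `a ∈ [99 / 100, 1]`**: certified losses up to distance `7`,
generic decay `53 / 1000 / k⁴` beyond. [folklore] -/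
theorem ig_far_bound_U1 {a : ℝ} (z z' : ℤ → ℝ) (s : ℤ → ℤ) (ha1 : 99 / 100 ≤ a) (ha2 : a ≤ 1)
    (hband : ∀ m : ℤ, (9 / 10 : ℝ) ^ 2 ≤ a ^ 2 / 3 + (z (m + 1) - z m) ^ 2 ∧
      a ^ 2 / 3 + (z (m + 1) - z m) ^ 2 ≤ (51 / 50 : ℝ) ^ 2)
    (hpos : ∀ m : ℤ, 0 < z (m + 1) - z m)
    (hz' : ∀ m : ℤ, (z' (m + 1) - z' m) ^ 2 = (z (m + 1) - z m) ^ 2 + a ^ 2 * (1 - (199 / 200 : ℝ) ^ 2) / 3)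
    (hpos' : ∀ m : ℤ, 0 < z' (m + 1) - z' m) (m m' : ℤ) (hk : 2 ≤ (m' - m).natAbs) :
    ((m' - m).natAbs ≤ 7 → -igEllU1 (m' - m).natAbs ≤
      layerInteraction lennardJones a (z m' - z m) (haggLabel s m' - haggLabel s m) 1 -
        layerInteraction lennardJones (199 / 200 * a) (z' m' - z' m) (haggLabel s m' - haggLabel s m) 1) ∧
    (8 ≤ (m' - m).natAbs → -((53 / 1000 : ℝ) / ((m' - m).natAbs : ℝ) ^ 4) ≤
      layerInteraction lennardJones a (z m' - z m) (haggLabel s m' - haggLabel s m) 1 -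
        layerInteraction lennardJones (199 / 200 * a) (z' m' - z' m) (haggLabel s m' - haggLabel s m) 1) := by
  have h1 : (9801 / 10000 : ℝ) ≤ a ^ 2 := by nlinarith
  have h2 : a ^ 2 ≤ (1 : ℝ) := by nlinarith
  obtain ⟨g1, g2, g3, g4⟩ := ig_far_geom_U (A₁ := 9801 / 10000) (A₂ := 1) (D₁ := 143 / 300) (D₂ := 7137 / 10000)
    (d₁ := 863 / 1250) (d₂ := 8449 / 10000) (β₁ := 672963 / 200000000) z z' h1 h2 (by norm_num) (by norm_num) (by norm_num)
    (by norm_num) (by norm_num) (by norm_num) (by norm_num) (by norm_num) (by norm_num) hband hpos hz' hpos' m m'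
  set k := (m' - m).natAbs with hk'
  have hk2 : (2 : ℝ) ≤ (k : ℝ) := by exact_mod_cast hk
  have hone : (1 : ℝ) ≤ (k : ℝ) ^ 2 * (143 / 300 : ℝ) := by nlinarith
  obtain ⟨⟨δ', hδ', hcert⟩, hgen⟩ := ig_far_diff_U (A₁ := 9801 / 10000) (A₂ := 1) (D₁ := 143 / 300) (D₂ := 7137 / 10000)
    (β₁ := 672963 / 200000000) (haggLabel s m' - haggLabel s m) (by norm_num) h1 h2 g1 g2 g3 g4 (by norm_num) hone
  constructor
  · intro hk7
    exact (ig_table_U1 k hk hk7 δ' hδ').trans hcert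
  · intro hk8
    refine le_trans ?_ hgen
    have hk8' : (8 : ℝ) ≤ (k : ℝ) := by exact_mod_cast hk8
    have hdec := ig_generic_decay4 (c := (672963 / 200000000 : ℝ) / (2 * (9801 / 10000 : ℝ) ^ 4)) (T := (143 / 300 : ℝ) / (9801 / 10000 : ℝ))
      (by norm_num) (by norm_num) hk8'
    have e1 : (672963 / 200000000 : ℝ) * (k : ℝ) ^ 2 / (2 * (9801 / 10000 : ℝ) ^ 4) = (672963 / 200000000 : ℝ) / (2 * (9801 / 10000 : ℝ) ^ 4) * (k : ℝ) ^ 2 := by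
      ring
    have e2 : (k : ℝ) ^ 2 * (143 / 300 : ℝ) / (9801 / 10000 : ℝ) = (k : ℝ) ^ 2 * ((143 / 300 : ℝ) / (9801 / 10000 : ℝ)) := by ring
    rw [e1, e2, neg_le_neg_iff]
    refine hdec.trans ?_
    have hk0 : (0 : ℝ) < (k : ℝ) := by linarith
    calc _ ≤ (53 / 1000 : ℝ) * ((k : ℝ)⁻¹) ^ 4 := mul_le_mul_of_nonneg_right (by norm_num) (by positivity)
      _ = _ := by rw [inv_pow, ← div_eq_mul_inv]
/-- **Far layers of the contraction on the window `a ∈ [1, 51 / 50]`**: certified losses up to distance `7`,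
generic decay `3 / 50 / k⁴` beyond. [folklore] -/
theorem ig_far_bound_U2 {a : ℝ} (z z' : ℤ → ℝ) (s : ℤ → ℤ) (ha1 : 1 ≤ a) (ha2 : a ≤ 51 / 50)
    (hband : ∀ m : ℤ, (9 / 10 : ℝ) ^ 2 ≤ a ^ 2 / 3 + (z (m + 1) - z m) ^ 2 ∧
      a ^ 2 / 3 + (z (m + 1) - z m) ^ 2 ≤ (51 / 50 : ℝ) ^ 2)
    (hpos : ∀ m : ℤ, 0 < z (m + 1) - z m)
    (hz' : ∀ m : ℤ, (z' (m + 1) - z' m) ^ 2 = (z (m + 1) - z m) ^ 2 + a ^ 2 * (1 - (199 / 200 : ℝ) ^ 2) / 3)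
    (hpos' : ∀ m : ℤ, 0 < z' (m + 1) - z' m) (m m' : ℤ) (hk : 2 ≤ (m' - m).natAbs) :
    ((m' - m).natAbs ≤ 7 → -igEllU2 (m' - m).natAbs ≤
      layerInteraction lennardJones a (z m' - z m) (haggLabel s m' - haggLabel s m) 1 -
        layerInteraction lennardJones (199 / 200 * a) (z' m' - z' m) (haggLabel s m' - haggLabel s m) 1) ∧
    (8 ≤ (m' - m).natAbs → -((3 / 50 : ℝ) / ((m' - m).natAbs : ℝ) ^ 4) ≤
      layerInteraction lennardJones a (z m' - z m) (haggLabel s m' - haggLabel s m) 1 -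
        layerInteraction lennardJones (199 / 200 * a) (z' m' - z' m) (haggLabel s m' - haggLabel s m) 1) := by
  have h1 : (1 : ℝ) ≤ a ^ 2 := by nlinarith
  have h2 : a ^ 2 ≤ (2601 / 2500 : ℝ) := by nlinarith
  obtain ⟨g1, g2, g3, g4⟩ := ig_far_geom_U (A₁ := 1) (A₂ := 2601 / 2500) (D₁ := 579 / 1250) (D₂ := 5303 / 7500)
    (d₁ := 1361 / 2000) (d₂ := 8409 / 10000) (β₁ := 140187 / 40000000) z z' h1 h2 (by norm_num) (by norm_num) (by norm_num)
    (by norm_num) (by norm_num) (by norm_num) (by norm_num) (by norm_num) (by norm_num) hband hpos hz' hpos' m m'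
  set k := (m' - m).natAbs with hk'
  have hk2 : (2 : ℝ) ≤ (k : ℝ) := by exact_mod_cast hk
  have hone : (1 : ℝ) ≤ (k : ℝ) ^ 2 * (579 / 1250 : ℝ) := by nlinarith
  obtain ⟨⟨δ', hδ', hcert⟩, hgen⟩ := ig_far_diff_U (A₁ := 1) (A₂ := 2601 / 2500) (D₁ := 579 / 1250) (D₂ := 5303 / 7500)
    (β₁ := 140187 / 40000000) (haggLabel s m' - haggLabel s m) (by norm_num) h1 h2 g1 g2 g3 g4 (by norm_num) hone
  constructor
  · intro hk7
    exact (ig_table_U2 k hk hk7 δ' hδ').trans hcert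
  · intro hk8
    refine le_trans ?_ hgen
    have hk8' : (8 : ℝ) ≤ (k : ℝ) := by exact_mod_cast hk8
    have hdec := ig_generic_decay4 (c := (140187 / 40000000 : ℝ) / (2 * (1 : ℝ) ^ 4)) (T := (579 / 1250 : ℝ) / (1 : ℝ))
      (by norm_num) (by norm_num) hk8'
    have e1 : (140187 / 40000000 : ℝ) * (k : ℝ) ^ 2 / (2 * (1 : ℝ) ^ 4) = (140187 / 40000000 : ℝ) / (2 * (1 : ℝ) ^ 4) * (k : ℝ) ^ 2 := by
      ring
    have e2 : (k : ℝ) ^ 2 * (579 / 1250 : ℝ) / (1 : ℝ) = (k : ℝ) ^ 2 * ((579 / 1250 : ℝ) / (1 : ℝ)) := by ring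
    rw [e1, e2, neg_le_neg_iff]
    refine hdec.trans ?_
    have hk0 : (0 : ℝ) < (k : ℝ) := by linarith
    calc _ ≤ (3 / 50 : ℝ) * ((k : ℝ)⁻¹) ^ 4 := mul_le_mul_of_nonneg_right (by norm_num) (by positivity)
      _ = _ := by rw [inv_pow, ← div_eq_mul_inv]
/-! ## Adjacent layers and the in-plane layer -/

/-- The layer interaction is even in the height. [folklore] -/
theorem ig_LI_neg_height (b H : ℝ) (δ : ℤ) :
    layerInteraction lennardJones b (-H) δ 1 = layerInteraction lennardJones b H δ 1 := by
  rw [ig_LI_eq, ig_LI_eq]; simp only [neg_sq]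

/-- Adjacent layers of a Hägg stacking are offset: their interaction is the `δ = 1` layer sum. [folklore] -/
theorem ig_LI_adjacent {s : ℤ → ℤ} (hs : IsHaggSeq s) (b H : ℝ) (m : ℤ) :
    layerInteraction lennardJones b H (haggLabel s (m + 1) - haggLabel s m) 1 = layerInteraction lennardJones b H 1 1 ∧
      layerInteraction lennardJones b H (haggLabel s (m - 1) - haggLabel s m) 1 =
        layerInteraction lennardJones b H 1 1 := by
  have e1 : haggLabel s (m + 1) - haggLabel s m = s m := by rw [haggLabel_succ]; ring
  have e2 : haggLabel s (m - 1) - haggLabel s m = -s (m - 1) := by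
    have := haggLabel_succ s (m - 1)
    rw [sub_add_cancel] at this
    linarith
  rw [e1, e2]
  constructor
  · rcases hs m with h | h <;> rw [h, layerInteraction_eq_ite, if_neg (by decide)]
  · rcases hs (m - 1) with h | h <;> rw [h, layerInteraction_eq_ite, if_neg (by decide)]

/-- **The two adjacent layers under the contraction.** [folklore] -/
theorem ig_adj_bound_U {a A₁ A₂ : ℝ} (z z' : ℤ → ℝ) {s : ℤ → ℤ} (hs : IsHaggSeq s) (hA₁ : 1 / 2 ≤ A₁)
    (h1 : A₁ ≤ a ^ 2) (h2 : a ^ 2 ≤ A₂)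
    (hband : ∀ m : ℤ, (9 / 10 : ℝ) ^ 2 ≤ a ^ 2 / 3 + (z (m + 1) - z m) ^ 2 ∧
      a ^ 2 / 3 + (z (m + 1) - z m) ^ 2 ≤ (51 / 50 : ℝ) ^ 2)
    (hz' : ∀ m : ℤ, (z' (m + 1) - z' m) ^ 2 = (z (m + 1) - z m) ^ 2 + a ^ 2 * (1 - (199 / 200 : ℝ) ^ 2) / 3)
    (m : ℤ) :
    igAdjSumU A₁ A₂ 4 ≤ layerInteraction lennardJones a (z (m + 1) - z m) (haggLabel s (m + 1) - haggLabel s m) 1 -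
        layerInteraction lennardJones (199 / 200 * a) (z' (m + 1) - z' m) (haggLabel s (m + 1) - haggLabel s m) 1 ∧
      igAdjSumU A₁ A₂ 4 ≤ layerInteraction lennardJones a (z (m - 1) - z m) (haggLabel s (m - 1) - haggLabel s m) 1 -
        layerInteraction lennardJones (199 / 200 * a) (z' (m - 1) - z' m) (haggLabel s (m - 1) - haggLabel s m) 1 := by
  unfold igAdjSumU
  constructor
  · rw [(ig_LI_adjacent hs a _ m).1, (ig_LI_adjacent hs (199 / 200 * a) _ m).1]
    have hb := hband m
    norm_num at hb
    exact ig_layer_adjU hA₁ h1 h2 (hz' m) (by linarith) (by linarith) 4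
  · rw [(ig_LI_adjacent hs a _ m).2, (ig_LI_adjacent hs (199 / 200 * a) _ m).2]
    have e1 : z (m - 1) - z m = -(z m - z (m - 1)) := by ring
    have e2 : z' (m - 1) - z' m = -(z' m - z' (m - 1)) := by ring
    rw [e1, e2, ig_LI_neg_height, ig_LI_neg_height]
    have hb := hband (m - 1)
    have hzz := hz' (m - 1)
    rw [sub_add_cancel] at hb hzz
    norm_num at hb
    exact ig_layer_adjU hA₁ h1 h2 hzz (by linarith) (by linarith) 4

/-- **The in-plane layer under the contraction**: six nearest neighbours at the worst spacing of the window plus the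
certified rings. [folklore] -/
theorem ig_in_bound_U {a A₁ A₂ : ℝ} (hA₁ : 1 / 2 ≤ A₁) (h1 : A₁ ≤ a ^ 2) (h2 : a ^ 2 ≤ A₂) (hA₂ : A₂ ≤ 11 / 10) :
    6 * (igE A₁ - igE (39601 / 40000 * A₁)) + igInSumU A₁ A₂ 4 ≤
      inLayerInteraction lennardJones a - inLayerInteraction lennardJones (199 / 200 * a) := by
  have h := ig_layer_inU hA₁ h1 h2 (N := 4) (by norm_num)
  have hcount := ig_cert_nncount4
  unfold igNNcount at hcount
  rw [hcount] at h
  unfold igInSumU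
  have hmono := ig_nn_mono_U (by linarith : 0 < A₁) h1 (h2.trans hA₂)
  linarith

/-! ## Summability of the layer families -/

/-- **Summability over the layers** of the layer family of a profile in the band (spacing `b² ∈ [4/5, 13/10]`,
increments `≥ 17/25`). [folklore] -/
theorem ig_summable_family {b : ℝ} (z : ℤ → ℝ) (s : ℤ → ℤ) (hb1 : 4 / 5 ≤ b ^ 2) (hb2 : b ^ 2 ≤ 13 / 10)
    (hz : ∀ m : ℤ, 17 / 25 ≤ z (m + 1) - z m) (m : ℤ) :
    Summable fun m' : ℤ => if m' = m then (0 : ℝ) else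
      layerInteraction lennardJones b (z m' - z m) (haggLabel s m' - haggLabel s m) 1 := by
  refine ig_summable_layers' z (by norm_num : (0 : ℝ) < 17 / 25) hz m _ (by norm_num : (0 : ℝ) ≤ 5) fun m' hk => ?_
  have hne : m' ≠ m := by rintro rfl; simp at hk
  rw [if_neg hne]
  have hge := ig_abs_height_ge z (by norm_num : (0 : ℝ) ≤ 17 / 25) hz m m'
  have hk2 : (2 : ℝ) ≤ ((m' - m).natAbs : ℝ) := by exact_mod_cast hk
  have hH : (17 / 25 * 2 : ℝ) ^ 2 ≤ (z m' - z m) ^ 2 := by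
    rw [← sq_abs (z m' - z m)]
    exact pow_le_pow_left₀ (by norm_num) (by nlinarith) 2
  exact ig_abs_LI_le hb1 (by nlinarith) (by nlinarith) _

end Summit.AtomisticToContinuum.Crystallization.Theorems.CleanHull

end
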